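import Literature.NumberTheory.Automorphic.ArchLocalTorusOrbitalDeriv   -- ★ §1 chain rule ∕ joint continuity of the derivative term along `k · t_w(z_ψ) · k⁻¹`
import HarnessLib

/-!
# At a DEFINITE archimedean place the torus orbital function is `C¹` along every one-angle curve — no support, no separation hypothesis

Topic `NumberTheory/Automorphic`; namespace `Literature.NumberTheory.Automorphic.UnitaryGroup`.  THEOREMS ONLY (no `def`, no instance, no notation, no named
fact, no `sorry`).  Cell `hodgecm-mathlib` (D-0151), floor 0, programme P3a, the `stub_ScCore` road of the pay-down line `Cruxes/H413/Lines/F0_P3a_SdArch.lean`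
(LEAD F0P3a-plan (g9) WORD T8-61 (A)): brick **(R3-e) «COMPACT-PLACE FLATNESS»** dealt by F0P3a-p02 (g10) 2026-09-01T04:57:14Z (head text verbatim below).

THE MATHEMATICS ([Rogawski1990, §14.5 p. 238, «`lim D_G(γ′) Φ(γ′, f′_v) = 0` at `v ∈ S₀`», §8.2 pp. 122–123]; [Folland1995, §2.6]; [DeitmarEchterhoff2014, Lemma 9.3.3]).
`L` a field with a complex place `w₀`, `H′ = diag(α)`, and the place DEFINITE: `σ_{w₀}(H′)` or `−σ_{w₀}(H′)` positive definite (`hpos`), so that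
`G′_{w₀} = U(σ_{w₀} H′)(ℂ) = archLocal L N (diagonal α) w₀` is COMPACT (★ `isCompact_archLocal_of_posDef`; §0 `compactSpace_archLocal_of_posDef`).  For a finite Borel
measure `μ` on `G′_{w₀}` (e.g. its Haar measure), a `C¹` test function `A : M_N(ℂ) → E` (NO support hypothesis) and a one-angle curve `ψ ↦ t(ψ) = diag(z_i e^{i c_i ψ})`
of the diagonal torus, the orbital function
`O(ψ) = ∫_{G′_{w₀}} A(↑↑(k · t(ψ) · k⁻¹)) dμ(k)`
is `C¹` on ALL of `ℝ` with `O′(ψ) = ∫ DA(↑↑(k·t(ψ)·k⁻¹))[↑k · diag(z_i · i c_i · e^{i c_i ψ}) · ↑k⁻¹] dμ(k)` — differentiation under the integral sign with the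
CONSTANT domination `sup_{closedBall ψ₀ 1 × G′_{w₀}} ‖∂_ψ‖ < ∞` (compactness), the integrands being continuous with (automatically) compact support; in particular
`O` and `O′` are bounded on `[−1, 1]`.  On the `G′`-side of Rogawski's (4.3.1) this is the input «the orbital integral is smooth THROUGH `ψ = 0`» at a definite place
(no singular hyperplane on a compact group), against which `h(ψ) τ(ψ) O(ψ)` with `h = O(ψ³)`, `|∂τ| ≤ C∕|ψ|` has derivative `→ 0` (p02 (g10)'s (R3-c)).
* §0 `compactSpace_archLocal_of_posDef`;
* §1 **`hasDerivAt_integral_comp_conj_circleDiagonal_of_posDef`** (derivative under the integral sign at every `ψ₀`, with integrability of the derivative term),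
  `continuous_integral_fderiv_apply_conj_circleDiagonal_of_posDef`, `deriv_…`, **`contDiff_one_integral_comp_conj_circleDiagonal_of_posDef`** (the dealt head),
  `exists_bound_integral_comp_conj_circleDiagonal_Icc_of_posDef` (`∃ M, ∀ ψ ∈ [−1,1], ‖O ψ‖ ≤ M ∧ ‖O′ ψ‖ ≤ M`).
Nothing of the cited sources is asserted; HC_CM is proved only modulo the printed citations until rung 0 closes.

## References
* [Rogawski1990] J. D. Rogawski, *Automorphic Representations of Unitary Groups in Three Variables*, Ann. of Math. Stud. 123 (1990), §14.5 p. 238; §8.2 pp. 122–123.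
* [Folland1995] G. B. Folland, *A Course in Abstract Harmonic Analysis* (1995), §2.6 (differentiation under the integral sign).
* [DeitmarEchterhoff2014] A. Deitmar, S. Echterhoff, *Principles of Harmonic Analysis*, 2nd ed. (2014), Lemma 9.3.3.
* [PlatonovRapinchuk1994] V. Platonov, A. Rapinchuk, *Algebraic Groups and Number Theory* (1994), §3.2 Thm 3.1 (anisotropic at `∞` ⇔ compact).
-/

set_option autoImplicit false

noncomputable section

open MeasureTheory Measure NumberField NumberField.InfinitePlace Filter Topology Set
open scoped Matrix MatrixGroups Real Classical ComplexOrder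
open scoped Matrix.Norms.Operator

namespace Literature.NumberTheory.Automorphic.UnitaryGroup

variable (L : Type) [Field L] (N : ℕ) (α : Fin N → L) (w₀ : {w : InfinitePlace L // IsComplex w})

/-! ## §0 A definite place gives a compact group -/

/-- **`G′_{w₀} = U(σ_{w₀} diag α)(ℂ)` is a compact space for a DEFINITE form** (★ `isCompact_archLocal_of_posDef` read on the subtype).
[cite: PlatonovRapinchuk1994, §3.2 Thm 3.1] -/
theorem compactSpace_archLocal_of_posDef
    (hpos : ((Matrix.diagonal α).map (w₀.1.embedding : L →+* ℂ)).PosDef ∨ (-((Matrix.diagonal α).map (w₀.1.embedding : L →+* ℂ))).PosDef) :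
    CompactSpace (archLocal L N (Matrix.diagonal α) w₀) :=
  isCompact_iff_compactSpace.1 (isCompact_archLocal_of_posDef L N (Matrix.diagonal α) w₀ hpos)

/-! ## §1 Differentiation under the integral sign on the compact group -/

variable {E : Type*} [NormedAddCommGroup E] [NormedSpace ℝ E]
  [MeasurableSpace (archLocal L N (Matrix.diagonal α) w₀)] [BorelSpace (archLocal L N (Matrix.diagonal α) w₀)]

/-- **THE TORUS ORBITAL FUNCTION AT A DEFINITE PLACE IS DIFFERENTIABLE ALONG EVERY ONE-ANGLE CURVE AT EVERY PARAMETER, WITH THE DERIVATIVE UNDER THE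
INTEGRAL SIGN** — `A` `C¹` on `M_N(ℂ)` (no support hypothesis), `μ` finite: `d∕dψ|_{ψ₀} ∫ A(↑↑(k·t(z_ψ)·k⁻¹)) dμ(k) = ∫ DA(↑↑(k·t(z_{ψ₀})·k⁻¹))[↑k·diag d′(ψ₀)·↑k⁻¹] dμ(k)`
(and the latter integrand is integrable).  Dominated differentiation (Mathlib `hasDerivAt_integral_of_dominated_loc_of_deriv_le`) on `ball ψ₀ 1` with a CONSTANT bound
(the derivative term is jointly continuous, ★ `continuous_fderiv_apply_conj_circleDiagonal_curve`, on the compact `closedBall ψ₀ 1 × G′_{w₀}`).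
[cite: Rogawski1990, §8.2 pp. 122–123; §14.5 p. 238] [cite: Folland1995, §2.6] -/
theorem hasDerivAt_integral_comp_conj_circleDiagonal_of_posDef
    (hpos : ((Matrix.diagonal α).map (w₀.1.embedding : L →+* ℂ)).PosDef ∨ (-((Matrix.diagonal α).map (w₀.1.embedding : L →+* ℂ))).PosDef)
    (μ : Measure (archLocal L N (Matrix.diagonal α) w₀)) [IsFiniteMeasure μ]
    (A : Matrix (Fin N) (Fin N) ℂ → E) (hA : ContDiff ℝ 1 A) (z : Fin N → Circle) (c : Fin N → ℝ) (ψ₀ : ℝ) :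
    Integrable (fun k : archLocal L N (Matrix.diagonal α) w₀ =>
      fderiv ℝ A ((((k * ⟨circleDiagonal N fun i => z i * Circle.exp (c i * ψ₀), circleDiagonal_mem_archLocal_diagonal L N α w₀ _⟩ * k⁻¹ :
          archLocal L N (Matrix.diagonal α) w₀) : GL (Fin N) ℂ) : Matrix (Fin N) (Fin N) ℂ))
        (((k : GL (Fin N) ℂ) : Matrix (Fin N) (Fin N) ℂ) * (Matrix.diagonal fun i => (z i : ℂ) * (Complex.exp ((c i * ψ₀ : ℝ) * Complex.I) * ((c i : ℂ) * Complex.I))) *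
          (((k⁻¹ : archLocal L N (Matrix.diagonal α) w₀) : GL (Fin N) ℂ) : Matrix (Fin N) (Fin N) ℂ))) μ ∧
    HasDerivAt (fun ψ : ℝ => ∫ k : archLocal L N (Matrix.diagonal α) w₀,
        A ((((k * ⟨circleDiagonal N fun i => z i * Circle.exp (c i * ψ), circleDiagonal_mem_archLocal_diagonal L N α w₀ _⟩ * k⁻¹ :
          archLocal L N (Matrix.diagonal α) w₀) : GL (Fin N) ℂ) : Matrix (Fin N) (Fin N) ℂ)) ∂μ)
      (∫ k : archLocal L N (Matrix.diagonal α) w₀,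
        fderiv ℝ A ((((k * ⟨circleDiagonal N fun i => z i * Circle.exp (c i * ψ₀), circleDiagonal_mem_archLocal_diagonal L N α w₀ _⟩ * k⁻¹ :
            archLocal L N (Matrix.diagonal α) w₀) : GL (Fin N) ℂ) : Matrix (Fin N) (Fin N) ℂ))
          (((k : GL (Fin N) ℂ) : Matrix (Fin N) (Fin N) ℂ) * (Matrix.diagonal fun i => (z i : ℂ) * (Complex.exp ((c i * ψ₀ : ℝ) * Complex.I) * ((c i : ℂ) * Complex.I))) *
            (((k⁻¹ : archLocal L N (Matrix.diagonal α) w₀) : GL (Fin N) ℂ) : Matrix (Fin N) (Fin N) ℂ)) ∂μ) ψ₀ := by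
  haveI : CompactSpace (archLocal L N (Matrix.diagonal α) w₀) := compactSpace_archLocal_of_posDef L N α w₀ hpos
  -- abbreviations: the integrand `F` and its `ψ`-derivative `F'`
  obtain ⟨F, hF⟩ : ∃ F : ℝ → archLocal L N (Matrix.diagonal α) w₀ → E, F = fun ψ k =>
      A ((((k * ⟨circleDiagonal N fun i => z i * Circle.exp (c i * ψ), circleDiagonal_mem_archLocal_diagonal L N α w₀ _⟩ * k⁻¹ :
        archLocal L N (Matrix.diagonal α) w₀) : GL (Fin N) ℂ) : Matrix (Fin N) (Fin N) ℂ)) := ⟨_, rfl⟩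
  obtain ⟨F', hF'⟩ : ∃ F' : ℝ → archLocal L N (Matrix.diagonal α) w₀ → E, F' = fun ψ k =>
      fderiv ℝ A ((((k * ⟨circleDiagonal N fun i => z i * Circle.exp (c i * ψ), circleDiagonal_mem_archLocal_diagonal L N α w₀ _⟩ * k⁻¹ :
          archLocal L N (Matrix.diagonal α) w₀) : GL (Fin N) ℂ) : Matrix (Fin N) (Fin N) ℂ))
        (((k : GL (Fin N) ℂ) : Matrix (Fin N) (Fin N) ℂ) * (Matrix.diagonal fun i => (z i : ℂ) * (Complex.exp ((c i * ψ : ℝ) * Complex.I) * ((c i : ℂ) * Complex.I))) *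
          (((k⁻¹ : archLocal L N (Matrix.diagonal α) w₀) : GL (Fin N) ℂ) : Matrix (Fin N) (Fin N) ℂ)) := ⟨_, rfl⟩
  -- (1) pointwise derivatives; continuity of `F ψ`, joint continuity of `F'`
  have hderiv : ∀ k ψ, HasDerivAt (fun ψ => F ψ k) (F' ψ k) ψ := fun k ψ => by
    rw [hF, hF']
    exact hasDerivAt_apply_conj_circleDiagonal_curve L N α w₀ A hA z c k ψ
  have hF'cont : Continuous (Function.uncurry F') := by
    rw [hF']
    exact continuous_fderiv_apply_conj_circleDiagonal_curve L N α w₀ A hA z c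
  have hAcont : Continuous fun k : archLocal L N (Matrix.diagonal α) w₀ => A (((k : GL (Fin N) ℂ) : Matrix (Fin N) (Fin N) ℂ)) :=
    hA.continuous.comp (Units.continuous_val.comp continuous_subtype_val)
  have hFcont : ∀ ψ, Continuous (F ψ) := fun ψ => by
    rw [hF]
    exact hAcont.comp ((continuous_id.mul continuous_const).mul continuous_id.inv)
  have hcs : ∀ f : archLocal L N (Matrix.diagonal α) w₀ → E, HasCompactSupport f := fun f =>
    IsCompact.of_isClosed_subset isCompact_univ (isClosed_tsupport f) (Set.subset_univ _)
  -- (2) a uniform bound on `closedBall ψ₀ 1 × G′_{w₀}` and the constant domination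
  obtain ⟨B, hB⟩ := ((isCompact_closedBall ψ₀ 1).prod (isCompact_univ (X := archLocal L N (Matrix.diagonal α) w₀))).exists_bound_of_continuousOn
    hF'cont.continuousOn
  have h_bound : ∀ᵐ k ∂μ, ∀ ψ ∈ Metric.ball ψ₀ 1, ‖F' ψ k‖ ≤ B :=
    Eventually.of_forall fun k ψ hψ => hB (ψ, k) ⟨Metric.ball_subset_closedBall hψ, Set.mem_univ _⟩
  -- (3) measurability ∕ integrability and the dominated differentiation theorem
  have hF_meas : ∀ᶠ ψ in 𝓝 ψ₀, AEStronglyMeasurable (F ψ) μ :=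
    Eventually.of_forall fun ψ => ((hFcont ψ).stronglyMeasurable_of_hasCompactSupport (hcs _)).aestronglyMeasurable
  have hF'_meas : ∀ ψ, AEStronglyMeasurable (F' ψ) μ := fun ψ =>
    ((hF'cont.comp (continuous_const.prodMk continuous_id)).stronglyMeasurable_of_hasCompactSupport (hcs _)).aestronglyMeasurable
  have hF_int : Integrable (F ψ₀) μ := by
    obtain ⟨B₀, hB₀⟩ := (isCompact_univ (X := archLocal L N (Matrix.diagonal α) w₀)).exists_bound_of_continuousOn (hFcont ψ₀).continuousOn
    exact (integrable_const B₀).mono' (hF_meas.self_of_nhds) (Eventually.of_forall fun k => hB₀ k (Set.mem_univ _))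
  have h_diff : ∀ᵐ k ∂μ, ∀ ψ ∈ Metric.ball ψ₀ 1, HasDerivAt (fun ψ => F ψ k) (F' ψ k) ψ :=
    Eventually.of_forall fun k ψ _ => hderiv k ψ
  have hmain := hasDerivAt_integral_of_dominated_loc_of_deriv_le (Metric.ball_mem_nhds ψ₀ one_pos) hF_meas hF_int (hF'_meas ψ₀) h_bound
    (integrable_const B) h_diff
  rw [hF, hF'] at hmain
  exact hmain

/-- **The derivative term integrates to a CONTINUOUS function of `ψ`** (locally dominated by a constant on the compact group; Mathlib `continuousAt_of_dominated`).
[cite: Rogawski1990, §8.2 pp. 122–123] [cite: Folland1995, §2.6] -/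
theorem continuous_integral_fderiv_apply_conj_circleDiagonal_of_posDef
    (hpos : ((Matrix.diagonal α).map (w₀.1.embedding : L →+* ℂ)).PosDef ∨ (-((Matrix.diagonal α).map (w₀.1.embedding : L →+* ℂ))).PosDef)
    (μ : Measure (archLocal L N (Matrix.diagonal α) w₀)) [IsFiniteMeasure μ]
    (A : Matrix (Fin N) (Fin N) ℂ → E) (hA : ContDiff ℝ 1 A) (z : Fin N → Circle) (c : Fin N → ℝ) :
    Continuous fun ψ : ℝ => ∫ k : archLocal L N (Matrix.diagonal α) w₀,
        fderiv ℝ A ((((k * ⟨circleDiagonal N fun i => z i * Circle.exp (c i * ψ), circleDiagonal_mem_archLocal_diagonal L N α w₀ _⟩ * k⁻¹ :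
            archLocal L N (Matrix.diagonal α) w₀) : GL (Fin N) ℂ) : Matrix (Fin N) (Fin N) ℂ))
          (((k : GL (Fin N) ℂ) : Matrix (Fin N) (Fin N) ℂ) * (Matrix.diagonal fun i => (z i : ℂ) * (Complex.exp ((c i * ψ : ℝ) * Complex.I) * ((c i : ℂ) * Complex.I))) *
            (((k⁻¹ : archLocal L N (Matrix.diagonal α) w₀) : GL (Fin N) ℂ) : Matrix (Fin N) (Fin N) ℂ)) ∂μ := by
  haveI : CompactSpace (archLocal L N (Matrix.diagonal α) w₀) := compactSpace_archLocal_of_posDef L N α w₀ hpos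
  obtain ⟨F', hF'⟩ : ∃ F' : ℝ → archLocal L N (Matrix.diagonal α) w₀ → E, F' = fun ψ k =>
      fderiv ℝ A ((((k * ⟨circleDiagonal N fun i => z i * Circle.exp (c i * ψ), circleDiagonal_mem_archLocal_diagonal L N α w₀ _⟩ * k⁻¹ :
          archLocal L N (Matrix.diagonal α) w₀) : GL (Fin N) ℂ) : Matrix (Fin N) (Fin N) ℂ))
        (((k : GL (Fin N) ℂ) : Matrix (Fin N) (Fin N) ℂ) * (Matrix.diagonal fun i => (z i : ℂ) * (Complex.exp ((c i * ψ : ℝ) * Complex.I) * ((c i : ℂ) * Complex.I))) *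
          (((k⁻¹ : archLocal L N (Matrix.diagonal α) w₀) : GL (Fin N) ℂ) : Matrix (Fin N) (Fin N) ℂ)) := ⟨_, rfl⟩
  have hF'cont : Continuous (Function.uncurry F') := by
    rw [hF']
    exact continuous_fderiv_apply_conj_circleDiagonal_curve L N α w₀ A hA z c
  have hcs : ∀ f : archLocal L N (Matrix.diagonal α) w₀ → E, HasCompactSupport f := fun f =>
    IsCompact.of_isClosed_subset isCompact_univ (isClosed_tsupport f) (Set.subset_univ _)
  have hF'_meas : ∀ ψ, AEStronglyMeasurable (F' ψ) μ := fun ψ =>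
    ((hF'cont.comp (continuous_const.prodMk continuous_id)).stronglyMeasurable_of_hasCompactSupport (hcs _)).aestronglyMeasurable
  have hcont : Continuous fun ψ => ∫ k, F' ψ k ∂μ := by
    refine continuous_iff_continuousAt.2 fun ψ₀ => ?_
    obtain ⟨B, hB⟩ := ((isCompact_closedBall ψ₀ 1).prod (isCompact_univ (X := archLocal L N (Matrix.diagonal α) w₀))).exists_bound_of_continuousOn
      hF'cont.continuousOn
    refine continuousAt_of_dominated (Eventually.of_forall hF'_meas) ?_ (integrable_const B) ?_
    · filter_upwards [Metric.closedBall_mem_nhds ψ₀ one_pos] with ψ hψ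
      exact Eventually.of_forall fun k => hB (ψ, k) ⟨hψ, Set.mem_univ _⟩
    · exact Eventually.of_forall fun k => (hF'cont.comp (continuous_id.prodMk continuous_const)).continuousAt
  rw [hF'] at hcont
  simpa only using hcont

/-- **The derivative of the orbital function at a definite place** (`hasDerivAt_…_of_posDef`). [cite: Rogawski1990, §8.2 pp. 122–123] -/
theorem deriv_integral_comp_conj_circleDiagonal_of_posDef
    (hpos : ((Matrix.diagonal α).map (w₀.1.embedding : L →+* ℂ)).PosDef ∨ (-((Matrix.diagonal α).map (w₀.1.embedding : L →+* ℂ))).PosDef)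
    (μ : Measure (archLocal L N (Matrix.diagonal α) w₀)) [IsFiniteMeasure μ]
    (A : Matrix (Fin N) (Fin N) ℂ → E) (hA : ContDiff ℝ 1 A) (z : Fin N → Circle) (c : Fin N → ℝ) (ψ₀ : ℝ) :
    deriv (fun ψ : ℝ => ∫ k : archLocal L N (Matrix.diagonal α) w₀,
        A ((((k * ⟨circleDiagonal N fun i => z i * Circle.exp (c i * ψ), circleDiagonal_mem_archLocal_diagonal L N α w₀ _⟩ * k⁻¹ :
          archLocal L N (Matrix.diagonal α) w₀) : GL (Fin N) ℂ) : Matrix (Fin N) (Fin N) ℂ)) ∂μ) ψ₀ =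
      ∫ k : archLocal L N (Matrix.diagonal α) w₀,
        fderiv ℝ A ((((k * ⟨circleDiagonal N fun i => z i * Circle.exp (c i * ψ₀), circleDiagonal_mem_archLocal_diagonal L N α w₀ _⟩ * k⁻¹ :
            archLocal L N (Matrix.diagonal α) w₀) : GL (Fin N) ℂ) : Matrix (Fin N) (Fin N) ℂ))
          (((k : GL (Fin N) ℂ) : Matrix (Fin N) (Fin N) ℂ) * (Matrix.diagonal fun i => (z i : ℂ) * (Complex.exp ((c i * ψ₀ : ℝ) * Complex.I) * ((c i : ℂ) * Complex.I))) *
            (((k⁻¹ : archLocal L N (Matrix.diagonal α) w₀) : GL (Fin N) ℂ) : Matrix (Fin N) (Fin N) ℂ)) ∂μ :=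
  (hasDerivAt_integral_comp_conj_circleDiagonal_of_posDef L N α w₀ hpos μ A hA z c ψ₀).2.deriv

/-- **(R3-e) «COMPACT-PLACE FLATNESS» — AT A DEFINITE PLACE THE TORUS ORBITAL FUNCTION IS `C¹` ON ALL OF `ℝ`** (head text of F0P3a-p02 (g10), 2026-09-01):
for `A` `C¹` on `M_N(ℂ)`, `μ` a finite Borel measure on the compact `G′_{w₀} = U(σ_{w₀} diag α)(ℂ)`, and a one-angle curve `t(ψ) = diag(z_i e^{i c_i ψ})`,
`ψ ↦ ∫_{G′_{w₀}} A(↑↑(k·t(ψ)·k⁻¹)) dμ(k)` is `ContDiff ℝ 1` (Mathlib `contDiff_one_iff_deriv`: differentiable everywhere by `hasDerivAt_…_of_posDef`, `deriv` continuous by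
`continuous_integral_fderiv_…_of_posDef`).  No singular hyperplane on a compact group: smooth THROUGH `ψ = 0`.
[cite: Rogawski1990, §14.5 p. 238; §8.2 pp. 122–123] [cite: Folland1995, §2.6] [cite: DeitmarEchterhoff2014, Lemma 9.3.3] -/
theorem contDiff_one_integral_comp_conj_circleDiagonal_of_posDef
    (hpos : ((Matrix.diagonal α).map (w₀.1.embedding : L →+* ℂ)).PosDef ∨ (-((Matrix.diagonal α).map (w₀.1.embedding : L →+* ℂ))).PosDef)
    (μ : Measure (archLocal L N (Matrix.diagonal α) w₀)) [IsFiniteMeasure μ]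
    (A : Matrix (Fin N) (Fin N) ℂ → E) (hA : ContDiff ℝ 1 A) (z : Fin N → Circle) (c : Fin N → ℝ) :
    ContDiff ℝ 1 fun ψ : ℝ => ∫ k : archLocal L N (Matrix.diagonal α) w₀,
        A ((((k * ⟨circleDiagonal N fun i => z i * Circle.exp (c i * ψ), circleDiagonal_mem_archLocal_diagonal L N α w₀ _⟩ * k⁻¹ :
          archLocal L N (Matrix.diagonal α) w₀) : GL (Fin N) ℂ) : Matrix (Fin N) (Fin N) ℂ)) ∂μ := by
  rw [contDiff_one_iff_deriv]
  refine ⟨fun ψ₀ => (hasDerivAt_integral_comp_conj_circleDiagonal_of_posDef L N α w₀ hpos μ A hA z c ψ₀).2.differentiableAt, ?_⟩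
  refine (continuous_integral_fderiv_apply_conj_circleDiagonal_of_posDef L N α w₀ hpos μ A hA z c).congr fun ψ₀ => ?_
  exact (deriv_integral_comp_conj_circleDiagonal_of_posDef L N α w₀ hpos μ A hA z c ψ₀).symm

/-- **Bounds on `[−1, 1]`**: `∃ M, ∀ ψ ∈ [−1, 1], ‖O(ψ)‖ ≤ M ∧ ‖O′(ψ)‖ ≤ M` for the orbital function `O` of the previous theorem (a `C¹` function and its derivative are
bounded on a compact interval). [cite: Rogawski1990, §14.5 p. 238] -/
theorem exists_bound_integral_comp_conj_circleDiagonal_Icc_of_posDef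
    (hpos : ((Matrix.diagonal α).map (w₀.1.embedding : L →+* ℂ)).PosDef ∨ (-((Matrix.diagonal α).map (w₀.1.embedding : L →+* ℂ))).PosDef)
    (μ : Measure (archLocal L N (Matrix.diagonal α) w₀)) [IsFiniteMeasure μ]
    (A : Matrix (Fin N) (Fin N) ℂ → E) (hA : ContDiff ℝ 1 A) (z : Fin N → Circle) (c : Fin N → ℝ) :
    ∃ M : ℝ, ∀ ψ ∈ Set.Icc (-1 : ℝ) 1,
      ‖∫ k : archLocal L N (Matrix.diagonal α) w₀,
          A ((((k * ⟨circleDiagonal N fun i => z i * Circle.exp (c i * ψ), circleDiagonal_mem_archLocal_diagonal L N α w₀ _⟩ * k⁻¹ :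
            archLocal L N (Matrix.diagonal α) w₀) : GL (Fin N) ℂ) : Matrix (Fin N) (Fin N) ℂ)) ∂μ‖ ≤ M ∧
      ‖deriv (fun ψ : ℝ => ∫ k : archLocal L N (Matrix.diagonal α) w₀,
          A ((((k * ⟨circleDiagonal N fun i => z i * Circle.exp (c i * ψ), circleDiagonal_mem_archLocal_diagonal L N α w₀ _⟩ * k⁻¹ :
            archLocal L N (Matrix.diagonal α) w₀) : GL (Fin N) ℂ) : Matrix (Fin N) (Fin N) ℂ)) ∂μ) ψ‖ ≤ M := by
  have h1 := contDiff_one_integral_comp_conj_circleDiagonal_of_posDef L N α w₀ hpos μ A hA z c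
  obtain ⟨M₁, hM₁⟩ := isCompact_Icc.exists_bound_of_continuousOn (h1.continuous.continuousOn (s := Set.Icc (-1 : ℝ) 1))
  obtain ⟨M₂, hM₂⟩ := isCompact_Icc.exists_bound_of_continuousOn ((contDiff_one_iff_deriv.1 h1).2.continuousOn (s := Set.Icc (-1 : ℝ) 1))
  exact ⟨max M₁ M₂, fun ψ hψ => ⟨(hM₁ ψ hψ).trans (le_max_left _ _), (hM₂ ψ hψ).trans (le_max_right _ _)⟩⟩

end Literature.NumberTheory.Automorphic.UnitaryGroup

end
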